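/-
Copyright (c) 2026 the pub-hodgecm-mathlib formalisation cell (harness21).  Prover seat hodgecm-mathlib-K2Liu-p05 (g0): Track B «K2-LIT»,
#184♮ = hLiu418 = stmt-HodgeConjecture-24832; socket #32d∕#32dR `sig_K2LiuDoublingHeightDecayLocal(R2)` of `Cruxes/HLiu418/Lines/K2_Liu_CurveThetaSigs_U5d_ZetaS.lean`
— organ (D): the torus decay of a `(P_Δ, modDelta)`-height in the doubled group at a split place; K2/STATUS 2026-09-04 (K2Liu-p05 (g0)).
-/
import Summits.HodgeConjecture.HodgeConjecture.Theorems.K2LiuDoublingSliceAtPlace          -- ★ (EV) `apply_eq_modDelta_mul_of_localDecomp`, ★ (A1) `exists_bound_and_inv_bound`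
import Summits.HodgeConjecture.HodgeConjecture.Theorems.K2LiuSplitCartanIwasawaGL          -- ★ (D1) the explicit decomposition at any split place
import Summits.HodgeConjecture.HodgeConjecture.Theorems.K2LiuUnramifiedSectionOnCartan     -- ★ #27: uniformizer-power bookkeeping, the `w`-component of `ι_v(t,1)`
import Literature.NumberTheory.Automorphic.SatakeParameterGenericBoundFlathProofs          -- ★ `isCompact_glInt_adicCompletion`
import HarnessLib

/-!
# Crux `HLiu418`, road `K2_Liu`, unit U5d, socket #32d∕#32dR — organ (D): THE TORUS DECAY IN THE DOUBLED GROUP AT A SPLIT PLACE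

Cell `hodgecm-mathlib`, crux item hLiu418 = `stmt-HodgeConjecture-24832`; squad K2 ∕ K2Liu, LEAD F0P6-plan (g10), prover K2Liu-p05 (g0).  THEOREMS ONLY
(no `def` ∕ instance ∕ notation ∕ named-fact hypothesis ∕ `sorry`, default heartbeats); lane `--supports stmt-HodgeConjecture-24832 --as helper`.

THE STATEMENT (`exists_torusDecay_split`).  In the K2Lit frame (`L` CM, `V = ⟨diag dV⟩`, `W = ⟨diag dW⟩` non-degenerate, `H = U(V^M ⊕ −V^M)` the doubled
group, `ι_v(·, 1) = iotaLeftLocPi v`, `ι_v^H = locToAdelic v`), at a finite place `v` of `L⁺` SPLIT in `L` (`w ∣ v`, `c w ≠ w`, uniformizer `ϖ` of `L_w`),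
for every continuous height `Φ > 0` of type `(P_Δ, modDelta)` on `H(𝔸)` there is `C ≥ 0` with
  `Φ(ι_v^H(ι_v(t, 1))) ≤ C · ∏_i (‖ϖ‖^{M∕2})^{|m_i|}`   for every `t ∈ U(V)(L⁺_v)` with `t_w = diag(ϖ^{m_i})`, `m ∈ ℤ^N`
— NO good-place hypothesis (the places `v ∈ S` of #32d are typically bad).

THE PROOF.  (D1) ★ `exists_isSiegelDelta_mul_glInt_of_diagonal` (this seat's bad-place form of ★ `K2LiuSplitCartanIwasawa`, K2Liu-p04): `ι_v(t,1) = p·k`,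
`p ∈ P_Δ(L⁺_v)`, `k_w ∈ GL_{2n}(𝒪_w)` — `k` in the COMPACT `splitEquivD⁻¹ GL_{2n}(𝒪_w)` —, `det_Δ(p_w) = ϖ^{M Σ m_i⁺}`, `c_*(det_Δ(p_{c⁻¹w})) = ϖ^{M Σ m_i⁻}`
(★ #27's uniformizer bookkeeping); (D2) `exists_le_modDelta_of_localDecomp_of_isCompact`: `Φ(ι_v^H p · ι_v^H k) ≤ c · modDelta(ι_v^H p)` for `k` in a
compact set (★ (EV) + ★ `exists_bound_and_inv_bound`); (D3) `modDelta_locToAdelic_eq_of_detDelta`: `modDelta(ι_v^H p) = ∏_{w′∣v} ‖det_Δ p_{w′}‖^{1∕2} =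
‖ϖ‖^{M(Σm⁺+Σm⁻)∕2} = ∏_i (‖ϖ‖^{M∕2})^{|m_i|}` (★ `modDelta_locToAdelic`, ★ `norm_galAdicCompletionMap`, `m⁺ + m⁻ = |m|`).
With ★ `integrable_placeSlice_of_localTorusDecay` (r = ‖ϖ‖^{M∕2}, `‖ϖ‖ = q_w⁻¹`) this is the finite slice of #32d∕#32dR at every split `v ∈ S`
(assembly file `K2LiuSplitSliceIntegrable`, next).

[Li1992, §3 Thm. 3.1]; [GelbartPiatetskishapiroRallis1987, Part A §6]; [Liu2011, §2C (2-4) p. 863]; [HarrisKudlaSweet1996, §1 (1.15)]; [Kudla1994, §3].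
HONEST LABEL.  Count-neutral helper: `HC_CM` is proved only modulo the 7 printed citations (2 remaining named inputs: hLiu418 = `stmt-HodgeConjecture-24832`,
h413 = `stmt-HodgeConjecture-24833`) until rung 0 closes.
-/

set_option autoImplicit false
-- the mandated namespace repeats the single-problem summit's segment (`HodgeConjecture.HodgeConjecture`)
set_option linter.dupNamespace false

noncomputable section

open scoped Matrix Kronecker
open NumberField IsDedekindDomain Matrix

namespace Summit.HodgeConjecture.HodgeConjecture.Cruxes.HLiu418.K2LiuSplitTorusDecay

open Literature.NumberTheory.Automorphic Literature.NumberTheory.Automorphic.UnitaryGroup Literature.NumberTheory.GaloisRepresentations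
open Literature.NumberTheory.GelbartRogawski1991 Literature.NumberTheory.GelbartRogawski1991.GRConstruction
open Literature.NumberTheory.GelbartRogawski1991.UnitaryDualPair
open Literature.NumberTheory.K2Lit Literature.NumberTheory.K2Lit.SiegelDoubled
open Summit.HodgeConjecture.HodgeConjecture.Cruxes.HLiu418.K2LiuSplitCartanIwasawaGL
open Summit.HodgeConjecture.HodgeConjecture.Cruxes.HLiu418.K2LiuUnramifiedSectionOnCartan
open Summit.HodgeConjecture.HodgeConjecture.Cruxes.HLiu418.K2LiuDoublingSliceAtPlace
open Summit.HodgeConjecture.HodgeConjecture.Cruxes.HLiu418.K2LiuDoublingHeightSliceQuasiInvariance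

variable (L : Type) [Field L] [NumberField L] [IsCMField L]
variable {N M n : ℕ} (e : Fin N × Fin M ≃ Fin n)
  (dV : Fin N → L) (hdV : ∀ i, IsCMField.complexConj L (dV i) = dV i)
  (dW : Fin M → L) (hdW : ∀ i, IsCMField.complexConj L (dW i) = dW i)
  (v : HeightOneSpectrum (𝓞 (Fp L)))

/-! ## (D2) A locally decomposed point has height `≲` the local modulus, for `k` in a compact set -/

/-- **`Φ(ι_v^H(p·k)) ≤ c · modDelta(ι_v^H p)`** for `p ∈ P_Δ(L⁺_v)` and `k` in a fixed COMPACT subset `C ⊆ H(L⁺_v)`, for a continuous height `Φ > 0` of type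
`(P_Δ, modDelta)` (★ (EV) `apply_eq_modDelta_mul_of_localDecomp` and the boundedness of `Φ ∘ ι_v^H` on the compact `ι_v^H(C)`, ★ `exists_bound_and_inv_bound`) —
the form of ★ `exists_twoSided_modDelta_of_localDecomp` with `H(𝒪_v)` replaced by any compact set (bad places).
[cite: Li1992, §3 Thm. 3.1] [cite: GelbartPiatetskishapiroRallis1987, Part A §6] -/
theorem exists_le_modDelta_of_localDecomp_of_isCompact {Φ : HA L e dV hdV dW hdW → ℝ} (hΦc : Continuous Φ) (hΦpos : ∀ x, 0 < Φ x)
    (hΦ : ∀ p x : HA L e dV hdV dW hdW, IsSiegelDelta L e dV hdV dW hdW p →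
      Φ (p * x) = modDelta L e dV hdV dW hdW p * Φ x)
    {C : Set (UnitaryGroup.localPi L (IsCMField.complexConj L) (n + n) (hermD L e dV hdV dW hdW) v)} (hC : IsCompact C) :
    ∃ c : ℝ, 0 < c ∧ ∀ (p k : UnitaryGroup.localPi L (IsCMField.complexConj L) (n + n) (hermD L e dV hdV dW hdW) v),
      p ∈ siegelDeltaLoc L e dV hdV dW hdW v → k ∈ C →
        Φ (locToAdelic L e dV hdV dW hdW v (p * k)) ≤
          c * modDelta L e dV hdV dW hdW (locToAdelic L e dV hdV dW hdW v p) := by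
  have hKc : IsCompact ((locToAdelic L e dV hdV dW hdW v) '' C) :=
    hC.image (UnitaryGroup.continuous_inclPlaceAdelic (Fp L) L (IsCMField.complexConj L) (n + n) (hermD L e dV hdV dW hdW) v)
  obtain ⟨B, hB, hBK⟩ := exists_bound_and_inv_bound L e dV hdV dW hdW hΦc hΦpos hKc
  refine ⟨B, hB, fun p k hp hk => ?_⟩
  have hkB := hBK (locToAdelic L e dV hdV dW hdW v k) (Set.mem_image_of_mem _ hk)
  rw [apply_eq_modDelta_mul_of_localDecomp L e dV hdV dW hdW v hΦ hp (map_mul _ p k), mul_comm B]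
  exact mul_le_mul_of_nonneg_left hkB.1 (modDelta_pos L e dV hdV dW hdW _).le

/-! ## (D3) The local modulus from the two `det_Δ`'s at a split place -/

/-- **`modDelta(ι_v^H p) = (‖det_Δ p_w‖ · ‖c_* det_Δ p_{c⁻¹w}‖)^{1∕2}`** at a split place `v` (`w ∣ v`, `c w ≠ w`), for `p ∈ P_Δ(L⁺_v)`: the places above `v` are
`{w, c⁻¹w}` (★ `LocalSplitting.univ_eq_pair`) and ★ `modDelta_locToAdelic` (every `det_Δ(p_{w′})` is a unit on `P_Δ`, ★ `isUnit_localDetDelta_of_mem_siegelDeltaLoc`).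
[cite: GelbartRogawski1991, §3.1 Prop. 3.1.1] [cite: HarrisKudlaSweet1996, §1 (1.15)] -/
theorem modDelta_locToAdelic_split (w : UnitaryGroup.PlacesOver L v) (hw : IsCMField.complexConj L • w.1 ≠ w.1)
    {p : UnitaryGroup.localPi L (IsCMField.complexConj L) (n + n) (hermD L e dV hdV dW hdW) v}
    (hp : p ∈ siegelDeltaLoc L e dV hdV dW hdW v) :
    modDelta L e dV hdV dW hdW (locToAdelic L e dV hdV dW hdW v p) =
      Real.sqrt ‖LocalSplitting.detDelta (Fp L) L (IsCMField.complexConj L) v n w p‖ *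
        Real.sqrt ‖LocalSplitting.detDelta (Fp L) L (IsCMField.complexConj L) v n (UnitaryGroup.PlacesOver.galInv (IsCMField.complexConj L) w) p‖ := by
  classical
  haveI : Algebra.IsQuadraticExtension (Fp L) L := IsCMField.isQuadraticExtension L
  rw [modDelta_locToAdelic L e dV hdV dW hdW v p (fun w' => isUnit_localDetDelta_of_mem_siegelDeltaLoc L e dV hdV dW hdW v hp w'),
    LocalSplitting.univ_eq_pair (Fp L) L (IsCMField.complexConj L) (complexConj_imagUnit L) (imagUnit_ne_zero L) v w,
    Finset.prod_pair (UnitaryGroup.PlacesOver.galInv_ne (IsCMField.complexConj L) w hw).symm]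
  rfl

/-! ## (D) The torus decay -/

omit [NumberField L] [IsCMField L] in
/-- exponent bookkeeping: `M Σ m_i⁺ + M Σ m_i⁻ = M Σ |m_i|`. [folklore] -/
theorem mul_sum_toNat_add_mul_sum_toNat_neg (m : Fin N → ℤ) :
    M * ∑ i, (m i).toNat + M * ∑ i, (-(m i)).toNat = M * ∑ i, (m i).natAbs := by
  rw [← Nat.mul_add, ← Finset.sum_add_distrib]
  exact congrArg _ (Finset.sum_congr rfl fun i _ => Int.toNat_add_toNat_neg_eq_natAbs (m i))

omit [NumberField L] [IsCMField L] in
/-- rpow bookkeeping: `√(r^{M S}) = (r^{M∕2})^S` for `r ≥ 0`. [folklore] -/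
theorem sqrt_pow_mul_eq_rpow_pow {r : ℝ} (hr : 0 ≤ r) (S : ℕ) :
    Real.sqrt (r ^ (M * S)) = (r ^ ((M : ℝ) / 2)) ^ S := by
  rw [Real.sqrt_eq_rpow, ← Real.rpow_natCast r (M * S), ← Real.rpow_mul hr, ← Real.rpow_mul_natCast hr]
  congr 1
  push_cast
  ring

omit [NumberField L] [IsCMField L] in
/-- rpow bookkeeping: `√(r^{M Σ m⁺}) · √(r^{M Σ m⁻}) = ∏_i (r^{M∕2})^{|m_i|}` for `r ≥ 0`. [folklore] -/
theorem sqrt_pow_mul_sqrt_pow_eq_prod {r : ℝ} (hr : 0 ≤ r) (m : Fin N → ℤ) :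
    Real.sqrt (r ^ (M * ∑ i, (m i).toNat)) * Real.sqrt (r ^ (M * ∑ i, (-(m i)).toNat)) =
      ∏ i, (r ^ ((M : ℝ) / 2)) ^ (m i).natAbs := by
  rw [← Real.sqrt_mul (pow_nonneg hr _), ← pow_add, mul_sum_toNat_add_mul_sum_toNat_neg (M := M) m, Finset.prod_pow_eq_pow_sum]
  exact sqrt_pow_mul_eq_rpow_pow hr _

/-- **the `w`-component of `ι_v(t, 1)` for `t_w = diag(ϖ^{m_i})`** is `reindex e₂ (diag(ϖ^{m_{(e⁻¹ j).1}}) ⊕ 1)` (★ `iotaLeftLocPi_apply`, ★ `coe_iotaVLocPi_apply`;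
★ #27's computation, isolated). [cite: Liu2011, §2C p. 863] [cite: HarrisKudlaSweet1996, §1 (1.11)] -/
theorem coe_iotaLeftLocPi_apply_of_diagonal (w : UnitaryGroup.PlacesOver L v) {ϖ : w.1.adicCompletion L} (m : Fin N → ℤ)
    (t : UnitaryGroup.localPi L (IsCMField.complexConj L) N (Matrix.diagonal dV) v)
    (ht : Units.val ((t : UnitaryGroup.LocalGLPi L N v) w) = Matrix.diagonal (fun i => ϖ ^ m i)) :
    (((iotaLeftLocPi L e dV hdV dW hdW v t :
        UnitaryGroup.localPi L (IsCMField.complexConj L) (n + n) (hermD L e dV hdV dW hdW) v) :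
          UnitaryGroup.LocalGLPi L (n + n) v) w : Matrix (Fin (n + n)) (Fin (n + n)) (w.1.adicCompletion L)) =
      Matrix.reindex (LocalSplitting.e₂ n) (LocalSplitting.e₂ n)
        (Matrix.fromBlocks (diagonal fun j : Fin n => ϖ ^ m (e.symm j).1) 0 0 1) := by
  rw [iotaLeftLocPi_apply, coe_iotaVLocPi_apply, ht]
  have h1 : Units.val (((1 : UnitaryGroup.localPi L (IsCMField.complexConj L) N (Matrix.diagonal dV) v) :
      UnitaryGroup.LocalGLPi L N v) w) = 1 := rfl
  have h2 : (Matrix.diagonal fun i => ϖ ^ m i) ⊗ₖ (1 : Matrix (Fin M) (Fin M) (w.1.adicCompletion L)) =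
      Matrix.diagonal fun p : Fin N × Fin M => ϖ ^ m p.1 := by
    rw [← Matrix.diagonal_one, Matrix.diagonal_kronecker_diagonal]
    simp only [mul_one]
  rw [h1, Matrix.one_kronecker_one, h2]
  simp only [Matrix.reindex_apply, Matrix.submatrix_diagonal_equiv, Matrix.submatrix_one_equiv]
  rfl

/-- **the local modulus from the two `det_Δ` powers**: `det_Δ(p_w) = ϖ^A`, `c_*(det_Δ(p_{c⁻¹w})) = ϖ^B` ⟹ `modDelta(ι_v^H p) = √(‖ϖ‖^A) · √(‖ϖ‖^B)`
(`modDelta_locToAdelic_split`, ★ `norm_galAdicCompletionMap`). [cite: GelbartRogawski1991, §3.1 Prop. 3.1.1] [cite: Kudla1994, §3] -/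
theorem modDelta_locToAdelic_of_detDelta_eq_pow (w : UnitaryGroup.PlacesOver L v) (hw : IsCMField.complexConj L • w.1 ≠ w.1)
    {ϖ : w.1.adicCompletion L} {p : UnitaryGroup.localPi L (IsCMField.complexConj L) (n + n) (hermD L e dV hdV dW hdW) v}
    (hp : p ∈ siegelDeltaLoc L e dV hdV dW hdW v) {A B : ℕ}
    (h₁ : LocalSplitting.detDelta (Fp L) L (IsCMField.complexConj L) v n w p = ϖ ^ A)
    (h₂ : galAdicCompletionMap (IsCMField.complexConj L) (smul_inv_smul (IsCMField.complexConj L) w.1)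
      (LocalSplitting.detDelta (Fp L) L (IsCMField.complexConj L) v n (UnitaryGroup.PlacesOver.galInv (IsCMField.complexConj L) w) p) = ϖ ^ B) :
    modDelta L e dV hdV dW hdW (locToAdelic L e dV hdV dW hdW v p) = Real.sqrt (‖ϖ‖ ^ A) * Real.sqrt (‖ϖ‖ ^ B) := by
  have hn₁ : Real.sqrt ‖LocalSplitting.detDelta (Fp L) L (IsCMField.complexConj L) v n w p‖ = Real.sqrt (‖ϖ‖ ^ A) := by
    rw [h₁, norm_pow]
  have hn₂ : Real.sqrt ‖LocalSplitting.detDelta (Fp L) L (IsCMField.complexConj L) v n (UnitaryGroup.PlacesOver.galInv (IsCMField.complexConj L) w) p‖ =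
      Real.sqrt (‖ϖ‖ ^ B) := by
    rw [← norm_galAdicCompletionMap (IsCMField.complexConj L) (smul_inv_smul (IsCMField.complexConj L) w.1)
      (LocalSplitting.detDelta (Fp L) L (IsCMField.complexConj L) v n (UnitaryGroup.PlacesOver.galInv (IsCMField.complexConj L) w) p), h₂, norm_pow]
  rw [modDelta_locToAdelic_split L e dV hdV dW hdW v w hw hp, ← hn₁, ← hn₂]

/-- **(D1)+(D3) packaged**: for `t_w = diag(ϖ^{m_i})`, `ι_v(t, 1) = p · k` with `p ∈ P_Δ(L⁺_v)`, `k_w ∈ GL_{2n}(𝒪_w)` (through ★ `splitEquivD` of the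
δ-package) and `modDelta(ι_v^H p) = ∏_i (‖ϖ‖^{M∕2})^{|m_i|}` — at ANY split place.
[cite: Li1992, §3 Thm. 3.1] [cite: GelbartPiatetskishapiroRallis1987, Part A §6] [cite: Kudla1994, §3] -/
theorem exists_localDecomp_of_diagonal (hdV0 : ∀ i, dV i ≠ 0) (hdW0 : ∀ j, dW j ≠ 0)
    (w : UnitaryGroup.PlacesOver L v) (hw : IsCMField.complexConj L • w.1 ≠ w.1)
    {ϖ : w.1.adicCompletion L} (hϖ : Valued.v ϖ = WithZero.exp (-1 : ℤ)) (m : Fin N → ℤ)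
    (t : UnitaryGroup.localPi L (IsCMField.complexConj L) N (Matrix.diagonal dV) v)
    (ht : Units.val ((t : UnitaryGroup.LocalGLPi L N v) w) = Matrix.diagonal (fun i => ϖ ^ m i)) :
    ∃ p k : UnitaryGroup.localPi L (IsCMField.complexConj L) (n + n) (hermD L e dV hdV dW hdW) v,
      p ∈ siegelDeltaLoc L e dV hdV dW hdW v ∧
      (haveI : Algebra.IsQuadraticExtension (Fp L) L := IsCMField.isQuadraticExtension L
       LocalSplitting.splitEquivD (Fp L) L (IsCMField.complexConj L) (complexConj_imagUnit L) (imagUnit_ne_zero L) v n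
          (gramR_isSymm L e dV hdV dW hdW) (isUnit_det_gramR₀ L e dV hdV hdV0 dW hdW hdW0) (hermD_eq_map_gramD L e dV hdV dW hdW) w hw k ∈
        glInt (n + n) (w.1.adicCompletion L)) ∧
      iotaLeftLocPi L e dV hdV dW hdW v t = p * k ∧
      modDelta L e dV hdV dW hdW (locToAdelic L e dV hdV dW hdW v p) = ∏ i, (‖ϖ‖ ^ ((M : ℝ) / 2)) ^ (m i).natAbs := by
  classical
  haveI : Algebra.IsQuadraticExtension (Fp L) L := IsCMField.isQuadraticExtension L
  have hϖ0 : ϖ ≠ 0 := fun h0 => by rw [h0, map_zero] at hϖ; exact WithZero.exp_ne_zero hϖ.symm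
  -- the exponents along `e` and the `w`-component of `ι_v(t, 1)`
  set m' : Fin n → ℤ := fun j => m (e.symm j).1 with hm'
  have hM₁ : ∑ j, (m' j).toNat = M * ∑ i, (m i).toNat := sum_comp_symm_fst e fun i => (m i).toNat
  have hM₂ : ∑ j, (-(m' j)).toNat = M * ∑ i, (-(m i)).toNat := sum_comp_symm_fst e fun i => (-(m i)).toNat
  have hh := coe_iotaLeftLocPi_apply_of_diagonal L e dV hdV dW hdW v w m t ht
  -- (D1): the explicit decomposition at the δ-package, ANY split place
  obtain ⟨p, k, hp, hk, hpk, hd₁, hd₂⟩ :=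
    exists_isSiegelDelta_mul_glInt_of_diagonal (Fp L) L (IsCMField.complexConj L) (complexConj_imagUnit L) (imagUnit_ne_zero L)
      (imagUnit_mul_self L) v n (gramR_isSymm L e dV hdV dW hdW) (isUnit_det_gramR₀ L e dV hdV hdV0 dW hdW hdW0)
      (hermD_eq_map_gramD L e dV hdV dW hdW) w hw (fun j => ϖ ^ m' j) (fun j => zpow_ne_zero _ hϖ0) _ hh
  have hp' : p ∈ siegelDeltaLoc L e dV hdV dW hdW v := (mem_siegelDeltaLoc_iff_local L e dV hdV dW hdW v p).2 hp
  -- the two `det_Δ`'s as uniformizer powers, then (D3)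
  have hP : ∀ j, ValuativeRel.valuation (w.1.adicCompletion L) ((fun j => ϖ ^ m' j) j) ≤ 1 ↔ 0 ≤ m' j :=
    fun j => valuation_zpow_le_one_iff L hϖ (m' j)
  rw [prod_ite_zpow_eq_pow_sum_toNat ϖ m' _ hP, hM₁] at hd₁
  rw [inv_prod_ite_zpow_eq_pow_sum_toNat ϖ m' _ hP, hM₂] at hd₂
  exact ⟨p, k, hp', hk, hpk, (modDelta_locToAdelic_of_detDelta_eq_pow L e dV hdV dW hdW v w hw hp' hd₁ hd₂).trans
    (sqrt_pow_mul_sqrt_pow_eq_prod (M := M) (norm_nonneg ϖ) m)⟩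

/-- **THE TORUS DECAY OF A `(P_Δ, modDelta)`-HEIGHT IN THE DOUBLED GROUP AT A SPLIT PLACE** (organ (D) of #32d∕#32dR; see the module docstring):
`∃ C ≥ 0, Φ(ι_v^H(ι_v(t, 1))) ≤ C · ∏_i (‖ϖ‖^{M∕2})^{|m_i|}` whenever `t_w = diag(ϖ^{m_i})`, at ANY split place.
[cite: Li1992, §3 Thm. 3.1] [cite: GelbartPiatetskishapiroRallis1987, Part A §6] [cite: Liu2011, §2C (2-4) p. 863] [cite: Kudla1994, §3] -/
theorem exists_torusDecay_split (hdV0 : ∀ i, dV i ≠ 0) (hdW0 : ∀ j, dW j ≠ 0)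
    (w : UnitaryGroup.PlacesOver L v) (hw : IsCMField.complexConj L • w.1 ≠ w.1)
    {ϖ : w.1.adicCompletion L} (hϖ : Valued.v ϖ = WithZero.exp (-1 : ℤ))
    {Φ : HA L e dV hdV dW hdW → ℝ} (hΦc : Continuous Φ) (hΦpos : ∀ x, 0 < Φ x)
    (hΦ : ∀ p x : HA L e dV hdV dW hdW, IsSiegelDelta L e dV hdV dW hdW p →
      Φ (p * x) = modDelta L e dV hdV dW hdW p * Φ x) :
    ∃ C : ℝ, 0 ≤ C ∧ ∀ (m : Fin N → ℤ) (t : UnitaryGroup.localPi L (IsCMField.complexConj L) N (Matrix.diagonal dV) v),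
      Units.val ((t : UnitaryGroup.LocalGLPi L N v) w) = Matrix.diagonal (fun i => ϖ ^ m i) →
        Φ (locToAdelic L e dV hdV dW hdW v (iotaLeftLocPi L e dV hdV dW hdW v t)) ≤
          C * ∏ i, (‖ϖ‖ ^ ((M : ℝ) / 2)) ^ (m i).natAbs := by
  classical
  haveI : Algebra.IsQuadraticExtension (Fp L) L := IsCMField.isQuadraticExtension L
  -- the split frame of the doubled group at `w` and the compact `splitEquivD⁻¹ GL_{2n}(𝒪_w)`
  let eD := LocalSplitting.splitEquivD (Fp L) L (IsCMField.complexConj L) (complexConj_imagUnit L) (imagUnit_ne_zero L) v n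
    (gramR_isSymm L e dV hdV dW hdW) (isUnit_det_gramR₀ L e dV hdV hdV0 dW hdW hdW0) (hermD_eq_map_gramD L e dV hdV dW hdW) w hw
  let Cset : Set (UnitaryGroup.localPi L (IsCMField.complexConj L) (n + n) (hermD L e dV hdV dW hdW) v) :=
    eD.toHomeomorph ⁻¹' (glInt (n + n) (w.1.adicCompletion L) : Set (GL (Fin (n + n)) (w.1.adicCompletion L)))
  have hCc : IsCompact Cset := eD.toHomeomorph.isCompact_preimage.2 (isCompact_glInt_adicCompletion (n + n) L w.1)
  obtain ⟨c, hc, hck⟩ := exists_le_modDelta_of_localDecomp_of_isCompact L e dV hdV dW hdW v hΦc hΦpos hΦ hCc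
  refine ⟨c, hc.le, fun m t ht => ?_⟩
  obtain ⟨p, k, hp', hk, hpk, hmod⟩ := exists_localDecomp_of_diagonal L e dV hdV dW hdW v hdV0 hdW0 w hw hϖ m t ht
  have hkC : k ∈ Cset := hk
  rw [hpk, ← hmod]
  exact hck p k hp' hkC

end Summit.HodgeConjecture.HodgeConjecture.Cruxes.HLiu418.K2LiuSplitTorusDecay

end
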